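import Mathlib
import Summits.Ventures.PercRepro2.BHK
import Summits.Ventures.PercRepro2.MergedUnionDefs
import Summits.Ventures.PercRepro2.MergedUnionPairDefs

/-!
# The four-function inequality for the pair (cluster, merged cluster) of `t`, and (PAIR-t)
(blind cell PercRepro2, mine-1 g34)

BHK06 Theorem 1.1 for the PAIR `(C_t, T*)`, `T* = C_t ∪ (C_X if t ↔ Y)`, on induced subgraphs:
for `Φ₁, Φ₂` nonnegative and monotone in both arguments and avoided sets `Xa, Ya ⊆ U`,

  `E(Φ₁(C^U_t, T*^U) 1_{R_{Xa}}) · E(Φ₂(C^U_t, T*^U) 1_{R_{Ya}})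
     ≤ E((Φ₁Φ₂)(C^U_t, T*^U) 1_{R_{Xa ∩ Ya}}) · P(R_{Xa ∪ Ya})`,  `R_Z = {T*^U ∩ Z = ∅}`.

The proof is the cell's `bhk_induced'` with the pair in place of the cluster: Harris when
`Xa ∩ Ya = ∅`; otherwise explore `Z = Xa ∩ Ya` — the transfer `pairObs_mul_indicator_eq` (built on
`mergedIn_sdiff_eq` / `RmEvent_union_eq`) moves every term to `G[U ∖ Z]` with the parameters
`(Y ∖ Z, X ∖ Z)` and the avoided sets enlarged by the ghost frontier, the tower identity turns each
term into a sum over the explored configuration, and the four functions theorem closes.  With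
`U = V` and `Xa = Ya = {s}` this is **(PAIR-t)**: the pair `(C_t, T*)` is positively associated
under `P(· | s ∉ T*) = P(· | s ↮ t, {s ↮ X} ∪ {t ↮ Y})` (`pair_pa`, `pair_pa_anti`), and with
`MergedUnionReduce.union_pa_of_pair` this gives **(UNION-PA)** unconditionally (`union_pa`).
-/

namespace Summit.Ventures.PercRepro2

namespace MergedU

section PairBHK

variable {V : Type*} {E : Type*} [Fintype E] [DecidableEq E] [Fintype V] [DecidableEq V]
  {R : Type*} [CommRing R] [LinearOrder R] [IsStrictOrderedRing R]

omit [DecidableEq E] [Fintype V] [LinearOrder R] [IsStrictOrderedRing R] in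
/-- **Pointwise transfer to `G[U ∖ Z]`** for the pair: for `t ∉ Z ⊆ U`,
`Φ(C^U_t, T*^U) 1_{R^U_{W∪Z}} = Φ(C^{U∖Z}_t, T*^{U∖Z}[Y∖Z,X∖Z]) 1_{R^{U∖Z}_{W ∪ ghostFrontier}}`
configuration by configuration. -/
lemma pairObs_mul_indicator_eq (ends : E → Sym2 V) {U Z : Finset V} (hZU : Z ⊆ U) {t : V}
    (htZ : t ∉ Z) (Y X : Finset V) (Φ : Set V → Set V → R) (W : Finset V) (ω : Config E) :
    (pairObs ends U t Y X Φ * (RmEvent ends U t Y X (W ∪ Z)).indicator (1 : Config E → R)) ω =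
      (pairObs ends (U \ Z) t (Y \ Z) (X \ Z) Φ *
        (RmEvent ends (U \ Z) t (Y \ Z) (X \ Z) (W ∪ ghostFrontier ends U Z X Y ω)).indicator
          (1 : Config E → R)) ω := by
  have key := Set.ext_iff.1 (RmEvent_union_eq (ends := ends) hZU htZ (Y := Y) (X := X) W) ω
  simp only [Set.mem_setOf_eq] at key
  simp only [Pi.mul_apply]
  by_cases h : ω ∈ RmEvent ends U t Y X (W ∪ Z)
  · have hZ : ∀ z ∈ Z, z ∉ mergedIn ends U t Y X ω :=
      fun z hz => h z (Finset.mem_union_right W hz)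
    have hR : ∀ z ∈ Z, ¬ Conn ends (induced ends (↑U) ω) t z := not_conn_of_RmEvent hZ
    rw [Set.indicator_of_mem h, Set.indicator_of_mem (key.1 h)]
    simp only [pairObs]
    rw [clusterIn_sdiff_eq hR, mergedIn_sdiff_eq hZ]
  · rw [Set.indicator_of_notMem h, Set.indicator_of_notMem fun h' => h (key.2 h'), mul_zero,
      mul_zero]

omit [LinearOrder R] [IsStrictOrderedRing R] in
/-- **Domain Markov identity for the pair**: for `t ∉ Z ⊆ U`,
`E(Φ(C^U_t,T*^U) 1_{R^U_{W∪Z}}) = ∑_ω weight p ω · E(Φ(C^{U∖Z}_t,T*^{U∖Z}) 1_{R^{U∖Z}_{W ∪ S ω}})`. -/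
theorem expect_pairObs_mul_indicator_eq_sum (p : E → R) (ends : E → Sym2 V) {U Z : Finset V}
    (hZU : Z ⊆ U) {t : V} (htZ : t ∉ Z) (Y X : Finset V) (Φ : Set V → Set V → R) (W : Finset V) :
    expect p (pairObs ends U t Y X Φ * (RmEvent ends U t Y X (W ∪ Z)).indicator 1) =
      ∑ ω, weight p ω * expect p (pairObs ends (U \ Z) t (Y \ Z) (X \ Z) Φ *
        (RmEvent ends (U \ Z) t (Y \ Z) (X \ Z) (W ∪ ghostFrontier ends U Z X Y ω)).indicator 1) := by
  have e : (pairObs ends U t Y X Φ * (RmEvent ends U t Y X (W ∪ Z)).indicator (1 : Config E → R)) =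
      fun ω => (pairObs ends (U \ Z) t (Y \ Z) (X \ Z) Φ *
        (RmEvent ends (U \ Z) t (Y \ Z) (X \ Z) (W ∪ ghostFrontier ends U Z X Y ω)).indicator
          (1 : Config E → R)) ω :=
    funext fun ω => pairObs_mul_indicator_eq ends hZU htZ Y X Φ W ω
  rw [e]
  exact expect_tower p (F₁ := fun _ => touches ends (↑Z)) (F₂ := fun _ => within ends (↑(U \ Z)))
    (S := ghostFrontier ends U Z X Y)
    (Φ := fun T => pairObs ends (U \ Z) t (Y \ Z) (X \ Z) Φ *
      (RmEvent ends (U \ Z) t (Y \ Z) (X \ Z) (W ∪ T)).indicator 1)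
    (fun _ => disjoint_touches_within_sdiff ends U Z)
    (fun T ω ω' h => by
      show (ghostFrontier ends U Z X Y ω = T) = (ghostFrontier ends U Z X Y ω' = T)
      rw [dependsOn_ghostFrontier Z h])
    fun T => dependsOn_mul (dependsOn_pairObs Φ)
      (dependsOn_indicator (dependsOn_RmEvent (W ∪ T)))

omit [Fintype V] in
/-- The case `Xa ∩ Ya = ∅`: Harris' inequality three times. -/
lemma pair_bhk_of_inter_eq_empty (p : E → R) (hp : IsProbVec p) (ends : E → Sym2 V) (t : V)
    (U Y X : Finset V) {Φ₁ Φ₂ : Set V → Set V → R}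
    (hΦ₁ : ∀ ⦃C C' D D' : Set V⦄, C ⊆ C' → D ⊆ D' → Φ₁ C D ≤ Φ₁ C' D')
    (hΦ₂ : ∀ ⦃C C' D D' : Set V⦄, C ⊆ C' → D ⊆ D' → Φ₂ C D ≤ Φ₂ C' D')
    (hΦ₁0 : ∀ C D, 0 ≤ Φ₁ C D) (hΦ₂0 : ∀ C D, 0 ≤ Φ₂ C D) (Xa Ya : Finset V)
    (hZ : Xa ∩ Ya = ∅) :
    expect p (pairObs ends U t Y X Φ₁ * (RmEvent ends U t Y X Xa).indicator 1) *
        expect p (pairObs ends U t Y X Φ₂ * (RmEvent ends U t Y X Ya).indicator 1) ≤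
      expect p (pairObs ends U t Y X (fun C D => Φ₁ C D * Φ₂ C D) *
          (RmEvent ends U t Y X (Xa ∩ Ya)).indicator 1) *
        prob p (RmEvent ends U t Y X (Xa ∪ Ya)) := by
  rw [hZ, RmEvent_empty, Set.indicator_univ, mul_one, RmEvent_union]
  have hRX := isLowerSet_RmEvent (ends := ends) (U := U) (t := t) (Y := Y) (X := X) Xa
  have hRY := isLowerSet_RmEvent (ends := ends) (U := U) (t := t) (Y := Y) (X := X) Ya
  have hm₁ := monotone_pairObs (ends := ends) (U := U) (t := t) (Y := Y) (X := X) hΦ₁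
  have hm₂ := monotone_pairObs (ends := ends) (U := U) (t := t) (Y := Y) (X := X) hΦ₂
  have h1 := expect_mul_indicator_le_of_isLowerSet hp hm₁ hRX
  have h2 := expect_mul_indicator_le_of_isLowerSet hp hm₂ hRY
  have h3 := expect_mul_expect_le_expect_mul hp hm₁ hm₂
  have h4 := prob_mul_prob_le_prob_inter_of_isLowerSet hp hRX hRY
  have n1 : 0 ≤ expect p (pairObs ends U t Y X Φ₂ * (RmEvent ends U t Y X Ya).indicator 1) :=
    expect_nonneg hp fun ω => mul_nonneg (hΦ₂0 _ _) (Set.indicator_apply_nonneg fun _ => zero_le_one)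
  have n2 : 0 ≤ expect p (pairObs ends U t Y X Φ₁) := expect_nonneg hp fun ω => hΦ₁0 _ _
  have n3 : 0 ≤ expect p (pairObs ends U t Y X Φ₁ * pairObs ends U t Y X Φ₂) :=
    expect_nonneg hp fun ω => mul_nonneg (hΦ₁0 _ _) (hΦ₂0 _ _)
  have e : pairObs ends U t Y X (fun C D => Φ₁ C D * Φ₂ C D) =
      pairObs ends U t Y X Φ₁ * pairObs ends U t Y X Φ₂ := rfl
  rw [e]
  calc expect p (pairObs ends U t Y X Φ₁ * (RmEvent ends U t Y X Xa).indicator 1) *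
        expect p (pairObs ends U t Y X Φ₂ * (RmEvent ends U t Y X Ya).indicator 1)
      ≤ (expect p (pairObs ends U t Y X Φ₁) * prob p (RmEvent ends U t Y X Xa)) *
          (expect p (pairObs ends U t Y X Φ₂) * prob p (RmEvent ends U t Y X Ya)) :=
        mul_le_mul h1 h2 n1 (mul_nonneg n2 (prob_nonneg hp _))
    _ = (expect p (pairObs ends U t Y X Φ₁) * expect p (pairObs ends U t Y X Φ₂)) *
          (prob p (RmEvent ends U t Y X Xa) * prob p (RmEvent ends U t Y X Ya)) := by ring
    _ ≤ expect p (pairObs ends U t Y X Φ₁ * pairObs ends U t Y X Φ₂) *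
          prob p (RmEvent ends U t Y X Xa ∩ RmEvent ends U t Y X Ya) :=
        mul_le_mul h3 h4 (mul_nonneg (prob_nonneg hp _) (prob_nonneg hp _)) n3

/-- **The four-function inequality for the pair `(C_t, T*)` on induced subgraphs** (BHK06 Theorem
1.1 for the pair; the ghost-graph induction): for `Φ₁, Φ₂` nonnegative and monotone in both
arguments, every `U`, parameters `Y, X` and avoided sets `Xa, Ya ⊆ U`,
`E(Φ₁ 1_{R_{Xa}}) · E(Φ₂ 1_{R_{Ya}}) ≤ E((Φ₁Φ₂) 1_{R_{Xa∩Ya}}) · P(R_{Xa∪Ya})`. -/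
theorem pair_bhk_induced (p : E → R) (hp : IsProbVec p) (ends : E → Sym2 V) (t : V)
    {Φ₁ Φ₂ : Set V → Set V → R}
    (hΦ₁ : ∀ ⦃C C' D D' : Set V⦄, C ⊆ C' → D ⊆ D' → Φ₁ C D ≤ Φ₁ C' D')
    (hΦ₂ : ∀ ⦃C C' D D' : Set V⦄, C ⊆ C' → D ⊆ D' → Φ₂ C D ≤ Φ₂ C' D')
    (hΦ₁0 : ∀ C D, 0 ≤ Φ₁ C D) (hΦ₂0 : ∀ C D, 0 ≤ Φ₂ C D) (U : Finset V) :
    ∀ Y X Xa Ya : Finset V, Xa ⊆ U → Ya ⊆ U →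
      expect p (pairObs ends U t Y X Φ₁ * (RmEvent ends U t Y X Xa).indicator 1) *
          expect p (pairObs ends U t Y X Φ₂ * (RmEvent ends U t Y X Ya).indicator 1) ≤
        expect p (pairObs ends U t Y X (fun C D => Φ₁ C D * Φ₂ C D) *
            (RmEvent ends U t Y X (Xa ∩ Ya)).indicator 1) *
          prob p (RmEvent ends U t Y X (Xa ∪ Ya)) := by
  have hΦ0 : ∀ C D, 0 ≤ Φ₁ C D * Φ₂ C D := fun C D => mul_nonneg (hΦ₁0 C D) (hΦ₂0 C D)
  have hnn : ∀ (U' Y' X' : Finset V) (Φ : Set V → Set V → R) (h0 : ∀ C D, 0 ≤ Φ C D)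
      (A : Finset V) (ω : Config E),
      0 ≤ (pairObs ends U' t Y' X' Φ * (RmEvent ends U' t Y' X' A).indicator (1 : Config E → R)) ω :=
    fun U' Y' X' Φ h0 A ω => mul_nonneg (h0 _ _) (Set.indicator_apply_nonneg fun _ => zero_le_one)
  induction U using Finset.strongInduction with
  | H U ih =>
  intro Y X Xa Ya hXa hYa
  by_cases hZ : Xa ∩ Ya = ∅
  · exact pair_bhk_of_inter_eq_empty p hp ends t U Y X hΦ₁ hΦ₂ hΦ₁0 hΦ₂0 Xa Ya hZ
  set Z := Xa ∩ Ya with hZdef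
  have hZX : Z ⊆ Xa := Finset.inter_subset_left
  have hZY : Z ⊆ Ya := Finset.inter_subset_right
  have hZU : Z ⊆ U := hZX.trans hXa
  by_cases htZ : t ∈ Z
  · -- `t ∈ Xa`: the left side vanishes
    have h0 : expect p (pairObs ends U t Y X Φ₁ * (RmEvent ends U t Y X Xa).indicator 1) = 0 := by
      rw [RmEvent_eq_empty_of_mem (hZX htZ)]
      simp [expect]
    rw [h0, zero_mul]
    exact mul_nonneg (expect_nonneg hp (hnn U Y X _ hΦ0 _)) (prob_nonneg hp _)
  have hU' : U \ Z ⊂ U := Finset.sdiff_ssubset hZU (Finset.nonempty_iff_ne_empty.2 hZ)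
  -- the four terms as sums over the explored configuration
  have e1 : expect p (pairObs ends U t Y X Φ₁ * (RmEvent ends U t Y X Xa).indicator 1) =
      ∑ ω, weight p ω * expect p (pairObs ends (U \ Z) t (Y \ Z) (X \ Z) Φ₁ *
        (RmEvent ends (U \ Z) t (Y \ Z) (X \ Z)
          ((Xa \ Z) ∪ ghostFrontier ends U Z X Y ω)).indicator 1) := by
    rw [← expect_pairObs_mul_indicator_eq_sum p ends hZU htZ Y X Φ₁ (Xa \ Z),
      Finset.sdiff_union_of_subset hZX]
  have e2 : expect p (pairObs ends U t Y X Φ₂ * (RmEvent ends U t Y X Ya).indicator 1) =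
      ∑ ω, weight p ω * expect p (pairObs ends (U \ Z) t (Y \ Z) (X \ Z) Φ₂ *
        (RmEvent ends (U \ Z) t (Y \ Z) (X \ Z)
          ((Ya \ Z) ∪ ghostFrontier ends U Z X Y ω)).indicator 1) := by
    rw [← expect_pairObs_mul_indicator_eq_sum p ends hZU htZ Y X Φ₂ (Ya \ Z),
      Finset.sdiff_union_of_subset hZY]
  have e3 : expect p (pairObs ends U t Y X (fun C D => Φ₁ C D * Φ₂ C D) *
      (RmEvent ends U t Y X Z).indicator 1) =
      ∑ ω, weight p ω * expect p (pairObs ends (U \ Z) t (Y \ Z) (X \ Z)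
        (fun C D => Φ₁ C D * Φ₂ C D) *
        (RmEvent ends (U \ Z) t (Y \ Z) (X \ Z) (∅ ∪ ghostFrontier ends U Z X Y ω)).indicator 1) := by
    rw [← expect_pairObs_mul_indicator_eq_sum p ends hZU htZ Y X _ ∅, Finset.empty_union]
  have e4 : prob p (RmEvent ends U t Y X (Xa ∪ Ya)) =
      ∑ ω, weight p ω * expect p (pairObs ends (U \ Z) t (Y \ Z) (X \ Z) (fun _ _ => 1) *
        (RmEvent ends (U \ Z) t (Y \ Z) (X \ Z)
          (((Xa \ Z) ∪ (Ya \ Z)) ∪ ghostFrontier ends U Z X Y ω)).indicator 1) := by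
    have e1' : pairObs ends U t Y X (fun _ _ => (1 : R)) = 1 := rfl
    rw [← expect_pairObs_mul_indicator_eq_sum p ends hZU htZ Y X (fun _ _ => 1)
      ((Xa \ Z) ∪ (Ya \ Z)), e1', one_mul, ← prob_eq_expect_indicator, ← Finset.union_sdiff_distrib,
      Finset.sdiff_union_of_subset (hZX.trans Finset.subset_union_left)]
  rw [e1, e2, e3, e4]
  refine four_functions_theorem_univ
    (fun ω => weight p ω * expect p (pairObs ends (U \ Z) t (Y \ Z) (X \ Z) Φ₁ *
      (RmEvent ends (U \ Z) t (Y \ Z) (X \ Z)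
        ((Xa \ Z) ∪ ghostFrontier ends U Z X Y ω)).indicator 1))
    (fun ω => weight p ω * expect p (pairObs ends (U \ Z) t (Y \ Z) (X \ Z) Φ₂ *
      (RmEvent ends (U \ Z) t (Y \ Z) (X \ Z)
        ((Ya \ Z) ∪ ghostFrontier ends U Z X Y ω)).indicator 1))
    (fun ω => weight p ω * expect p (pairObs ends (U \ Z) t (Y \ Z) (X \ Z)
      (fun C D => Φ₁ C D * Φ₂ C D) *
      (RmEvent ends (U \ Z) t (Y \ Z) (X \ Z) (∅ ∪ ghostFrontier ends U Z X Y ω)).indicator 1))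
    (fun ω => weight p ω * expect p (pairObs ends (U \ Z) t (Y \ Z) (X \ Z) (fun _ _ => 1) *
      (RmEvent ends (U \ Z) t (Y \ Z) (X \ Z)
        (((Xa \ Z) ∪ (Ya \ Z)) ∪ ghostFrontier ends U Z X Y ω)).indicator 1))
    (fun ω => mul_nonneg (weight_nonneg hp ω) (expect_nonneg hp (hnn _ _ _ _ hΦ₁0 _)))
    (fun ω => mul_nonneg (weight_nonneg hp ω) (expect_nonneg hp (hnn _ _ _ _ hΦ₂0 _)))
    (fun ω => mul_nonneg (weight_nonneg hp ω) (expect_nonneg hp (hnn _ _ _ _ hΦ0 _)))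
    (fun ω => mul_nonneg (weight_nonneg hp ω)
      (expect_nonneg hp (hnn _ _ _ _ (fun _ _ => zero_le_one) _))) ?_
  intro ω ω'
  have hX'' : (Xa \ Z) ∪ ghostFrontier ends U Z X Y ω ⊆ U \ Z :=
    Finset.union_subset (Finset.sdiff_subset_sdiff hXa (le_refl Z)) (ghostFrontier_subset ω)
  have hY'' : (Ya \ Z) ∪ ghostFrontier ends U Z X Y ω' ⊆ U \ Z :=
    Finset.union_subset (Finset.sdiff_subset_sdiff hYa (le_refl Z)) (ghostFrontier_subset ω')
  have hIH := ih (U \ Z) hU' (Y \ Z) (X \ Z) ((Xa \ Z) ∪ ghostFrontier ends U Z X Y ω)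
    ((Ya \ Z) ∪ ghostFrontier ends U Z X Y ω') hX'' hY''
  -- `S(ω ⊓ ω') ⊆ S(ω) ∩ S(ω') ⊆ Xa'' ∩ Ya''`
  have h3 : expect p (pairObs ends (U \ Z) t (Y \ Z) (X \ Z) (fun C D => Φ₁ C D * Φ₂ C D) *
      (RmEvent ends (U \ Z) t (Y \ Z) (X \ Z)
        (((Xa \ Z) ∪ ghostFrontier ends U Z X Y ω) ∩
          ((Ya \ Z) ∪ ghostFrontier ends U Z X Y ω'))).indicator 1) ≤
      expect p (pairObs ends (U \ Z) t (Y \ Z) (X \ Z) (fun C D => Φ₁ C D * Φ₂ C D) *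
        (RmEvent ends (U \ Z) t (Y \ Z) (X \ Z)
          (∅ ∪ ghostFrontier ends U Z X Y (ω ⊓ ω'))).indicator 1) := by
    refine expect_mono hp fun ω₀ => ?_
    simp only [Pi.mul_apply]
    refine mul_le_mul_of_nonneg_left ?_ (hΦ0 _ _)
    refine Set.indicator_le_indicator_of_subset (RmEvent_anti ?_) (fun _ => zero_le_one) ω₀
    rw [Finset.empty_union]
    exact (ghostFrontier_inf_subset ω ω').trans
      (Finset.inter_subset_inter Finset.subset_union_right Finset.subset_union_right)
  -- `Xa'' ∪ Ya'' = (Xa' ∪ Ya') ∪ S(ω ⊔ ω')`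
  have h4 : prob p (RmEvent ends (U \ Z) t (Y \ Z) (X \ Z)
      (((Xa \ Z) ∪ ghostFrontier ends U Z X Y ω) ∪ ((Ya \ Z) ∪ ghostFrontier ends U Z X Y ω'))) =
      expect p (pairObs ends (U \ Z) t (Y \ Z) (X \ Z) (fun _ _ => 1) *
        (RmEvent ends (U \ Z) t (Y \ Z) (X \ Z)
          (((Xa \ Z) ∪ (Ya \ Z)) ∪ ghostFrontier ends U Z X Y (ω ⊔ ω'))).indicator 1) := by
    have e1' : pairObs ends (U \ Z) t (Y \ Z) (X \ Z) (fun _ _ => (1 : R)) = 1 := rfl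
    rw [e1', one_mul, ← prob_eq_expect_indicator, ghostFrontier_sup]
    congr 2
    ext x
    simp only [Finset.mem_union]
    tauto
  have n3 : 0 ≤ expect p (pairObs ends (U \ Z) t (Y \ Z) (X \ Z) (fun C D => Φ₁ C D * Φ₂ C D) *
      (RmEvent ends (U \ Z) t (Y \ Z) (X \ Z)
        (∅ ∪ ghostFrontier ends U Z X Y (ω ⊓ ω'))).indicator 1) :=
    expect_nonneg hp (hnn _ _ _ _ hΦ0 _)
  have n4 : 0 ≤ prob p (RmEvent ends (U \ Z) t (Y \ Z) (X \ Z)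
      (((Xa \ Z) ∪ ghostFrontier ends U Z X Y ω) ∪ ((Ya \ Z) ∪ ghostFrontier ends U Z X Y ω'))) :=
    prob_nonneg hp _
  calc weight p ω * expect p (pairObs ends (U \ Z) t (Y \ Z) (X \ Z) Φ₁ *
          (RmEvent ends (U \ Z) t (Y \ Z) (X \ Z)
            ((Xa \ Z) ∪ ghostFrontier ends U Z X Y ω)).indicator 1) *
        (weight p ω' * expect p (pairObs ends (U \ Z) t (Y \ Z) (X \ Z) Φ₂ *
          (RmEvent ends (U \ Z) t (Y \ Z) (X \ Z)
            ((Ya \ Z) ∪ ghostFrontier ends U Z X Y ω')).indicator 1))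
      = (weight p ω * weight p ω') *
          (expect p (pairObs ends (U \ Z) t (Y \ Z) (X \ Z) Φ₁ *
            (RmEvent ends (U \ Z) t (Y \ Z) (X \ Z)
              ((Xa \ Z) ∪ ghostFrontier ends U Z X Y ω)).indicator 1) *
          expect p (pairObs ends (U \ Z) t (Y \ Z) (X \ Z) Φ₂ *
            (RmEvent ends (U \ Z) t (Y \ Z) (X \ Z)
              ((Ya \ Z) ∪ ghostFrontier ends U Z X Y ω')).indicator 1)) := by ring
    _ ≤ (weight p ω * weight p ω') *
          (expect p (pairObs ends (U \ Z) t (Y \ Z) (X \ Z) (fun C D => Φ₁ C D * Φ₂ C D) *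
            (RmEvent ends (U \ Z) t (Y \ Z) (X \ Z)
              (∅ ∪ ghostFrontier ends U Z X Y (ω ⊓ ω'))).indicator 1) *
          expect p (pairObs ends (U \ Z) t (Y \ Z) (X \ Z) (fun _ _ => 1) *
            (RmEvent ends (U \ Z) t (Y \ Z) (X \ Z)
              (((Xa \ Z) ∪ (Ya \ Z)) ∪ ghostFrontier ends U Z X Y (ω ⊔ ω'))).indicator 1)) :=
        mul_le_mul_of_nonneg_left (hIH.trans (mul_le_mul h3 (le_of_eq h4) n4 n3))
          (mul_nonneg (weight_nonneg hp ω) (weight_nonneg hp ω'))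
    _ = weight p (ω ⊓ ω') * expect p (pairObs ends (U \ Z) t (Y \ Z) (X \ Z)
          (fun C D => Φ₁ C D * Φ₂ C D) *
          (RmEvent ends (U \ Z) t (Y \ Z) (X \ Z)
            (∅ ∪ ghostFrontier ends U Z X Y (ω ⊓ ω'))).indicator 1) *
        (weight p (ω ⊔ ω') * expect p (pairObs ends (U \ Z) t (Y \ Z) (X \ Z) (fun _ _ => 1) *
          (RmEvent ends (U \ Z) t (Y \ Z) (X \ Z)
            (((Xa \ Z) ∪ (Ya \ Z)) ∪ ghostFrontier ends U Z X Y (ω ⊔ ω'))).indicator 1)) := by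
        rw [← weight_inf_mul_weight_sup p ω ω']
        ring

end PairBHK

end MergedU

end Summit.Ventures.PercRepro2
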